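import Summits.CriticalPhenomena.PercolationContinuityZ3.Theorems.PercNearOneGluingNoHeavyQuantGluedPieceMargin
import Summits.CriticalPhenomena.PercolationContinuityZ3.Theorems.PercNearOneGluingNoHeavyQuantSliceDomination
import HarnessLib

/-!
# QUANT lane R8, T-DEC: the GLUED-PIECE SLICE IN THE BAND reduced to ONE price-domination statement — `LawDec.GluedDominated`
# (single-layer domination of the certificates of `gate_a(β ∗ t)`, `t = {0: 1−q, r: q(1−g), r+k: qg}`) and the kernel reduction
# `GluedDominated →` the glued-piece slice in the band (arm-1 gen 58, architect)

builds on p205010 (kernel theorem, internal audit signed; external expert review pending)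

Statement + support file (`--supports stmt-CriticalPhenomena-4575`), QUANT lane seat prim-quant-arm-1 (gen 58, architect); memo
`run/shared/lean/prim/quant/prim-quant-arm-1-g58/ARCH-G58.md` §0–§3.  One small definition (`LawDec.gluedPullback`), one `@[conjecture]`
(`LawDec.GluedDominated`), theorems with standard axioms, no sorries.

THE OPEN STATEMENT (arm-1 g57, `…QuantPiecewiseSibling` hypothesis `hGPS`, `…QuantGluedPieceMargin`): the GLUED-PIECE SLICE — `β` SDEC + affordable
at `x` on `{0..B}`, `t = gate {r, r+k; g} q = {0: 1−q, r: q(1−g), r+k: qg}`, `x ≤ qg` ⟹ `SDEC x (B+(r+k)) (β ∗ t)` — is a THEOREM off the band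
(`sdec_gluedPiece_of_margin`) and OPEN in the BAND `(m − r)/k < x ≤ qg`, `m = q(r+kg) > 2r`.  THIS FILE gives the band the architecture that closed
the heavy-blob slice (census-2 g54/g55: `SliceDominated`, `SliceSingleLayer`, `sliceClosedAll_of_dominated`):

* The certificates.  `SDEC x (B+(r+k)) (β ∗ t)` asks, for every gate `0 < a ≤ 1` and layer `j`, that `ν_a = gate (β ∗ t) a` be DEC(j) at floor
  `y = a·x` and target `T = a(S + m)` (`S` = mean of `β`); by strong duality (`decAtT_iff_prices`) this is the weak-duality inequality for every
  price system `(α, p)` of `ν_a` at `(y, T, j)`.  As a functional of `β` that inequality reads `(1−a)·e(0) + a·Σ_h β(h)·Ψ(h) ≤ 0`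
  (`glued_functional_eq`), where `e = coefAt T j α p` and **`Ψ = gluedPullback`**: `Ψ(h) = (1−q)·e(h) + q(1−g)·e(h+r) + qg·e(h+r+k)`.
* **`LawDec.GluedDominated`** (`@[conjecture]`): every such certificate is dominated ROW BY ROW by a price system `(α′, β′)` of the gated first factor
  `G = gate β a` at ONE layer `J ≤ B` (target `aS`, floor `y`), plus a multiple `λ` of the mean identity `Σ_h β(h)(h − S) = 0`, plus the gate row
  `(1−a)·e(0) ≤ (1−a)·e′(0)` for the un-tripled gate zero.  EVIDENCE (kit j287335 / j287338, `--workitem 4575`; float LPs with exact re-check of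
  every failure; ≈ 2·10⁵ price systems — random extreme points of the price polytope, component-image directions, the local-transfer violators;
  edges `x = qg`, `x ↓ (m−r)/k`, `S = xB`, `g ↑ 1`, `a ↓ 0`): 0 failures; for `a = 1` the layer given by the RULE `J = max(j − r − k, h_c)`,
  `h_c` = the largest CHEAP atom (`−Ψ(h) < (1−y)/y · max_lows Ψ`), with `(α′, β′) := Ψ` itself and `λ = 0` works in every instance (the
  slice programme's single-layer phenomenon); the tilt `λ` is needed only for the gate row when `a < 1` (small `B`, `S < 1`).
  WHY a single layer `j` does NOT suffice (memo §1): the image under `t` of a TIGHT LIGHT mid pair `{l, h; γ}` of `G` with `h + r + k > j`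
  (its `r+k`-copy lands above the layer — a light WINDOW pair) is not DEC at the raised target; every other valid component (points, giant pairs,
  heavy mid pairs, deep light pairs) transfers locally (exact census, memo §1); the window pairs are dominated from the layer `j − r − k`.
* **`LawDec.sdec_gluedPiece_band_of_dominated : GluedDominated →`** the glued-piece slice for every `β`, in the band and out of it
  (`x ≤ qg`, affordable): weak duality at the dominating layer (`dual_le_of_decAtT`, the DEC datum of `G` from `SDEC β` / Theorem A), the mean
  identity, the gate row, and strong duality for `ν_a`.
* `LawDec.glued_functional_eq`, `LawDec.gate_functional_eq` — the bookkeeping identities.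

HONEST STATUS.  `GluedDominated` is OPEN (evidence above); with it the glued-piece slice, hence (arm-1 g57 `sdec_cons_of_okPieces`, numerically every
sampled tree-OK sibling) the law-level node `SiblingStep`; `GateStepN`, `LightResidDECOracle`, `FarTreeRow` remain OPEN.  RATE class (log\*) / honest
sentence of `run/shared/lean/prim/quant/README.md` unchanged.  [this work].  Nothing here is cited as a published result.  LP duality
[cite: Schrijver1986, Cor 7.1f (p. 90)] (through `…QuantLawDecStrongDuality`).  The gluing rows served [cite: KozmaNitzan2024, Conjecture 3 (p. 15)];
product measure [cite: Grimmett1999, §1.3 p. 10].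
-/

noncomputable section

open scoped BigOperators

namespace Summit.CriticalPhenomena.PercolationContinuityZ3.Theorems
namespace Quant

open Finset

namespace LawDec

/-- the point mass `δ_K` -/
local notation3 "δ[" K "]" => (fun k : ℕ => if k = (K : ℕ) then (1 : ℝ) else 0)

/-- the two-point law `{lo, lo+K; g}` = `lo` sure relays and a blob of size `K` at gate `g` -/
local notation3 "TPL[" lo ", " K ", " g "]" => lconv lo K δ[lo] (gate δ[K] g)

/-! ### The pullback of a certificate of `gate (β ∗ t) a` to the atoms of `β` -/

/-- **the glued pullback**: `Ψ(h) = (1−q)·e(h) + q(1−g)·e(h+r) + qg·e(h+r+k)`, `e = coefAt T j α p` — the value of a price system of the positions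
`{0..B+r+k}` on the image `δ_h ∗ t` of the atom `h`, `t = {0: 1−q, r: q(1−g), r+k: qg}`. [this work] -/
def gluedPullback (T q g : ℝ) (j r k : ℕ) (α p : ℕ → ℝ) (h : ℕ) : ℝ :=
  (1 - q) * coefAt T j α p h + q * (1 - g) * coefAt T j α p (h + r) + q * g * coefAt T j α p (h + r + k)

/-- Fubini for a functional of a convolution: `Σ_{u ≤ M₁+M₂} e(u)·(μ₁ ∗ μ₂)(u) = Σ_{h ≤ M₁} μ₁(h)·Σ_{i ≤ M₂} μ₂(i)·e(h+i)`. [folklore] -/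
theorem sum_mul_lconv_fubini (M₁ M₂ : ℕ) (μ₁ μ₂ e : ℕ → ℝ) :
    ∑ u ∈ Finset.range (M₁ + M₂ + 1), e u * lconv M₁ M₂ μ₁ μ₂ u
      = ∑ h ∈ Finset.range (M₁ + 1), μ₁ h * ∑ i ∈ Finset.range (M₂ + 1), μ₂ i * e (h + i) := by
  simp only [lconv]
  simp_rw [Finset.mul_sum]
  rw [Finset.sum_comm]
  refine Finset.sum_congr rfl fun h hh => ?_
  rw [Finset.sum_comm]
  refine Finset.sum_congr rfl fun i hi => ?_
  rw [Finset.mem_range] at hh hi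
  have ee : ∀ u : ℕ, e u * (if h + i = u then μ₁ h * μ₂ i else 0) = if u = h + i then μ₁ h * (μ₂ i * e (h + i)) else 0 := by
    intro u
    by_cases hu : u = h + i
    · subst hu; rw [if_pos rfl, if_pos rfl]; ring
    · rw [if_neg (fun h' => hu h'.symm), if_neg hu, mul_zero]
  simp_rw [ee]
  rw [Finset.sum_ite_eq' (Finset.range (M₁ + M₂ + 1)) (h + i), if_pos (Finset.mem_range.2 (by omega))]

/-- the value of `e` on the glued law `t = gate {r, r+k; g} q` shifted by `h`: `Σ_{i ≤ r+k} t(i)·e(h+i) = (1−q)e(h) + q(1−g)e(h+r) + qg e(h+r+k)`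
(`r ≥ 1`). [this work] -/
theorem sum_glued_shift (q g : ℝ) (r k h : ℕ) (hr : 1 ≤ r) (e : ℕ → ℝ) :
    ∑ i ∈ Finset.range (r + k + 1), gate (TPL[r, k, g]) q i * e (h + i)
      = (1 - q) * e h + q * (1 - g) * e (h + r) + q * g * e (h + r + k) := by
  have et : ∀ i : ℕ, gate (TPL[r, k, g]) q i * e (h + i)
      = q * g * ((if i = r + k then (1 : ℝ) else 0) * e (h + i)) + q * (1 - g) * ((if i = r then (1 : ℝ) else 0) * e (h + i))
        + (1 - q) * ((if i = 0 then (1 : ℝ) else 0) * e (h + i)) := by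
    intro i
    rw [gate_apply, tpLaw_apply]
    ring
  simp_rw [et]
  rw [Finset.sum_add_distrib, Finset.sum_add_distrib, ← Finset.mul_sum, ← Finset.mul_sum, ← Finset.mul_sum]
  have pick : ∀ c : ℕ, c ≤ r + k → ∑ i ∈ Finset.range (r + k + 1), (if i = c then (1 : ℝ) else 0) * e (h + i) = e (h + c) := by
    intro c hc
    have e2 : ∀ i : ℕ, (if i = c then (1 : ℝ) else 0) * e (h + i) = if i = c then e (h + c) else 0 := by
      intro i; by_cases hi : i = c
      · subst hi; simp
      · simp [hi]
    simp_rw [e2]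
    rw [Finset.sum_ite_eq' (Finset.range (r + k + 1)) c, if_pos (Finset.mem_range.2 (by omega))]
  rw [pick (r + k) le_rfl, pick r (by omega), pick 0 (by omega), Nat.add_zero, ← Nat.add_assoc]
  ring

/-- `Σ_{h ≤ N} h·[h = c] = c` for `c ≤ N`. [folklore] -/
theorem sum_nat_mul_delta (N c : ℕ) (hc : c ≤ N) :
    ∑ h ∈ Finset.range (N + 1), (h : ℝ) * (if h = c then (1 : ℝ) else 0) = c := by
  have e : ∀ h ∈ Finset.range (N + 1), (h : ℝ) * (if h = c then (1 : ℝ) else 0) = if h = c then (c : ℝ) else 0 := by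
    intro h _
    by_cases hh : h = c
    · rw [if_pos hh, if_pos hh, hh, mul_one]
    · rw [if_neg hh, if_neg hh, mul_zero]
  rw [Finset.sum_congr rfl e, Finset.sum_ite_eq' (Finset.range (N + 1)) c, if_pos (Finset.mem_range.2 (by omega))]

/-- **the certificate functional of `gate (β ∗ t) a` as a functional of `β`**: for `β` vanishing above `B` and any `e`,
`Σ_{u ≤ B+(r+k)} e(u)·gate (β ∗ t) a (u) = (1−a)·e(0) + a·Σ_{h ≤ B} β(h)·[(1−q)e(h) + q(1−g)e(h+r) + qg e(h+r+k)]`. [this work] -/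
theorem glued_functional_eq (B r k : ℕ) (β e : ℕ → ℝ) (q g a : ℝ) (hr : 1 ≤ r) :
    ∑ u ∈ Finset.range (B + (r + k) + 1), e u * gate (lconv B (r + k) β (gate (TPL[r, k, g]) q)) a u
      = (1 - a) * e 0 + a * ∑ h ∈ Finset.range (B + 1), β h * ((1 - q) * e h + q * (1 - g) * e (h + r) + q * g * e (h + r + k)) := by
  have eg : ∀ u : ℕ, e u * gate (lconv B (r + k) β (gate (TPL[r, k, g]) q)) a u
      = a * (e u * lconv B (r + k) β (gate (TPL[r, k, g]) q) u) + (1 - a) * (e u * (if u = 0 then (1 : ℝ) else 0)) := by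
    intro u; rw [gate_apply]; ring
  simp_rw [eg]
  rw [Finset.sum_add_distrib, ← Finset.mul_sum, ← Finset.mul_sum, sum_mul_lconv_fubini,
    sum_mul_indicator e (B + (r + k)) 0 (Nat.zero_le _)]
  have inner : ∀ h ∈ Finset.range (B + 1), β h * ∑ i ∈ Finset.range (r + k + 1), gate (TPL[r, k, g]) q i * e (h + i)
      = β h * ((1 - q) * e h + q * (1 - g) * e (h + r) + q * g * e (h + r + k)) := by
    intro h _; rw [sum_glued_shift q g r k h hr e]
  rw [Finset.sum_congr rfl inner]
  ring

/-- **the certificate functional of the gated first factor**: `Σ_{u ≤ B} e(u)·gate β a (u) = (1−a)·e(0) + a·Σ_{h ≤ B} β(h)·e(h)`. [this work] -/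
theorem gate_functional_eq (B : ℕ) (β e : ℕ → ℝ) (a : ℝ) :
    ∑ u ∈ Finset.range (B + 1), e u * gate β a u = (1 - a) * e 0 + a * ∑ h ∈ Finset.range (B + 1), β h * e h := by
  have eg : ∀ u : ℕ, e u * gate β a u = a * (β u * e u) + (1 - a) * (e u * (if u = 0 then (1 : ℝ) else 0)) := by
    intro u; rw [gate_apply]; ring
  simp_rw [eg]
  rw [Finset.sum_add_distrib, ← Finset.mul_sum, ← Finset.mul_sum, sum_mul_indicator e B 0 (Nat.zero_le _)]
  ring

/-! ### The conjecture -/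

/-- **CONJECTURE (single-layer domination of the certificates of the glued-piece slice; arm-1 g58, memo ARCH-G58 §2).**  Frame: floor `0 < x < 1`,
gate `0 < a ≤ 1`, glued piece `0 < q < 1`, `0 ≤ g ≤ 1`, `r, k ≥ 1` in the BAND (`x ≤ qg`, `2r < m := q(r+kg)`, `m − r < kx`), a first factor on
`{0..B}` of mean `S` with `xB ≤ S ≤ B`, a layer `j < B + (r+k)`; write `y = ax`, `T₀ = aS`, `T = a(S + m)`.  For EVERY price system `(α, p)` of
the positions `{0..B+(r+k)}` at `(y, T, j)` (`p ≥ 0`; `α l ≤ usage·p h` for `l ≤ j`, `2l < T`, `h ≤ B+(r+k)` compatible) there are a layer `J ≤ B`,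
a price system `(α′, β′)` of `{0..B}` at `(y, T₀, J)` and a real `λ` such that, with `Ψ = gluedPullback T q g j r k α p`:
`Ψ(h) ≤ coefAt T₀ J α′ β′ h + λ(h − S)` for every `h ≤ B`, and `(1−a)·coefAt T j α p 0 ≤ (1−a)·coefAt T₀ J α′ β′ 0` (the gate row).
No law enters.  EVIDENCE: file header (kit j287335/j287338; 0 failures).  Implies the glued-piece slice in the band
(`sdec_gluedPiece_band_of_dominated`). [this work] [status: open] -/
@[conjecture] def GluedDominated : Prop :=
  ∀ (x a q g S : ℝ) (B r k j : ℕ) (α p : ℕ → ℝ),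
    0 < x → x < 1 → 0 < a → a ≤ 1 → 0 < q → q < 1 → 0 ≤ g → g ≤ 1 → 1 ≤ r → 1 ≤ k →
    x ≤ q * g → 2 * (r : ℝ) < q * ((r : ℝ) + k * g) → q * ((r : ℝ) + k * g) - r < (k : ℝ) * x →
    x * (B : ℝ) ≤ S → S ≤ (B : ℝ) → j < B + (r + k) →
    (∀ h, 0 ≤ p h) →
    (∀ l h, l ≤ j → 2 * (l : ℝ) < a * (S + q * ((r : ℝ) + k * g)) → h ≤ B + (r + k) →
      (j + 1 ≤ h ∨ a * (S + q * ((r : ℝ) + k * g)) < (l : ℝ) + h) →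
      α l ≤ usage (a * x) (a * (S + q * ((r : ℝ) + k * g))) j l h * p h) →
    ∃ (J : ℕ) (α' β' : ℕ → ℝ) (lam : ℝ), J ≤ B ∧ (∀ h, 0 ≤ β' h) ∧
      (∀ l h, l ≤ J → 2 * (l : ℝ) < a * S → h ≤ B → (J + 1 ≤ h ∨ a * S < (l : ℝ) + h) →
        α' l ≤ usage (a * x) (a * S) J l h * β' h) ∧
      (∀ h, h ≤ B → gluedPullback (a * (S + q * ((r : ℝ) + k * g))) q g j r k α p h
        ≤ coefAt (a * S) J α' β' h + lam * ((h : ℝ) - S)) ∧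
      (1 - a) * coefAt (a * (S + q * ((r : ℝ) + k * g))) j α p 0 ≤ (1 - a) * coefAt (a * S) J α' β' 0

/-! ### The reduction -/

/-- law facts of the glued law `t = gate {r, r+k; g} q`: nonnegative, vanishing above `r+k`, mass `1`, mean `q(r+kg)`. [this work] -/
theorem glued_laws (q g : ℝ) (r k : ℕ) (hq0 : 0 ≤ q) (hq1 : q ≤ 1) (hg0 : 0 ≤ g) (hg1 : g ≤ 1) :
    (∀ h, 0 ≤ gate (TPL[r, k, g]) q h) ∧ (∀ h, r + k < h → gate (TPL[r, k, g]) q h = 0) ∧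
      (∑ h ∈ Finset.range (r + k + 1), gate (TPL[r, k, g]) q h = 1) ∧
      (∑ h ∈ Finset.range (r + k + 1), (h : ℝ) * gate (TPL[r, k, g]) q h = q * ((r : ℝ) + k * g)) := by
  obtain ⟨t0, tM, t1, tmn, _⟩ := hs_facts r k g hg0 hg1
  obtain ⟨q0', qM', q1'⟩ := gate_laws (r + k) (TPL[r, k, g]) q hq0 hq1 t0 tM t1
  exact ⟨q0', qM', q1', by rw [sum_mul_gate, tmn]⟩

/-- **`GluedDominated` ⟹ THE GLUED-PIECE SLICE** (in the band; the margin case is `sdec_gluedPiece_of_margin`).  `β` a probability law on `{0..B}`,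
affordable and SDEC at `0 < x < 1`; glued piece `0 < q < 1`, `0 ≤ g ≤ 1`, `r, k ≥ 1`, `x ≤ qg`, band `2r < q(r+kg)`, `q(r+kg) − r < kx`
⟹ `SDEC x (B + (r+k)) (β ∗ gate {r,r+k;g} q)`.  Proof: for a gate `a` and a layer `j`, strong duality (`decAtT_iff_prices`) asks the weak-duality
inequality for every price system of `ν_a = gate (β ∗ t) a`; its functional is `(1−a)e(0) + aΣ_h β(h)Ψ(h)` (`glued_functional_eq`); the rows of
`GluedDominated` bound it by `(1−a)e′(0) + aΣ_h β(h)e′(h) + aλΣ_h β(h)(h − S)`; the last sum vanishes (`S` = mean), and the rest is the functional of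
`(α′, β′)` on `gate β a` (`gate_functional_eq`), nonpositive by weak duality (`dual_le_of_decAtT`) since `gate β a` is DEC(J) — `J < B` by `SDEC β`,
`J = B` by Theorem A. [this work] -/
theorem sdec_gluedPiece_band_of_dominated (hD : GluedDominated) {x : ℝ} (hx0 : 0 < x) (hx1 : x < 1) {B : ℕ} {β : ℕ → ℝ}
    (β0 : ∀ h, 0 ≤ β h) (βM : ∀ h, B < h → β h = 0) (β1 : ∑ h ∈ Finset.range (B + 1), β h = 1)
    (hta : x * (B : ℝ) ≤ ∑ h ∈ Finset.range (B + 1), (h : ℝ) * β h) (hS : SDEC x B β)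
    (q g : ℝ) (r k : ℕ) (hq0 : 0 < q) (hq1 : q < 1) (hg0 : 0 ≤ g) (hg1 : g ≤ 1) (hr : 1 ≤ r) (hk : 1 ≤ k)
    (hxqg : x ≤ q * g) (hband1 : 2 * (r : ℝ) < q * ((r : ℝ) + k * g)) (hband2 : q * ((r : ℝ) + k * g) - r < (k : ℝ) * x) :
    SDEC x (B + (r + k)) (lconv B (r + k) β (gate (TPL[r, k, g]) q)) := by
  set S : ℝ := ∑ h ∈ Finset.range (B + 1), (h : ℝ) * β h with hSdef
  set m : ℝ := q * ((r : ℝ) + k * g) with hmdef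
  set t : ℕ → ℝ := gate (TPL[r, k, g]) q with htdef
  obtain ⟨t0, tM, t1, tmn⟩ := glued_laws q g r k hq0.le hq1.le hg0 hg1
  -- mean of β is at most its top
  have hSB : S ≤ (B : ℝ) := by
    have : ∑ h ∈ Finset.range (B + 1), (h : ℝ) * β h ≤ ∑ h ∈ Finset.range (B + 1), (B : ℝ) * β h :=
      Finset.sum_le_sum fun h hh => mul_le_mul_of_nonneg_right
        (by exact_mod_cast Nat.lt_succ_iff.1 (Finset.mem_range.1 hh)) (β0 h)
    rw [← Finset.mul_sum, β1, mul_one] at this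
    exact this
  intro a ha0 ha1 j hj
  -- law facts of ν_a = gate (β ∗ t) a
  have c1 : ∑ h ∈ Finset.range (B + (r + k) + 1), lconv B (r + k) β t h = 1 := sum_lconv B (r + k) β t β1 t1
  obtain ⟨n0, nM, n1⟩ := gate_laws (B + (r + k)) (lconv B (r + k) β t) a ha0.le ha1
    (lconv_nonneg B (r + k) β t β0 t0) (fun h hh => lconv_eq_zero B (r + k) β t h hh) c1
  have nmean : ∑ h ∈ Finset.range (B + (r + k) + 1), (h : ℝ) * gate (lconv B (r + k) β t) a h = a * (S + m) := by
    rw [sum_mul_gate, sum_mul_lconv B (r + k) β t β1 t1, tmn]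
  have hy0 : 0 < a * x := mul_pos ha0 hx0
  have hy1 : a * x < 1 := by nlinarith
  rw [decAt_iff_decAtT, nmean, decAtT_iff_prices (a * x) _ j (B + (r + k)) _ hy0 hy1 nM n1]
  intro α p hp hαp
  have hjM : j ≤ B + (r + k) := hj.le
  -- the certificate functional
  have hfun := dual_functional_eq (a * (S + m)) j (B + (r + k)) α p (gate (lconv B (r + k) β t) a) hjM
  rw [htdef, glued_functional_eq B r k β (coefAt (a * (S + m)) j α p) q g a hr] at hfun
  -- the dominating layer
  obtain ⟨J, α', β', lam, hJB, hβ', hαβ', hrows, hgate⟩ :=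
    hD x a q g S B r k j α p hx0 hx1 ha0 ha1 hq0 hq1 hg0 hg1 hr hk hxqg hband1 hband2 hta hSB hj hp hαp
  -- G = gate β a is DEC(J) at its mean a·S
  obtain ⟨G0, GM, G1⟩ := gate_laws B β a ha0.le ha1 β0 βM β1
  have Gmean : ∑ h ∈ Finset.range (B + 1), (h : ℝ) * gate β a h = a * S := by rw [sum_mul_gate]
  have hdecJ : DECAtT (a * x) (a * S) J B (gate β a) := by
    rw [← Gmean, ← decAt_iff_decAtT]
    rcases Nat.lt_or_ge J B with hJlt | hJge
    · exact hS a ha0 ha1 J hJlt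
    · refine decAt_of_top_le B (gate β a) G0 GM G1 (a * x) hy1 (fun h hh => ?_) J hJge
      have hhB : h ≤ B := by
        by_contra hc
        exact absurd (GM h (not_le.1 hc)) (ne_of_gt hh)
      rw [Gmean]
      have h1 : a * x * (h : ℝ) ≤ a * x * (B : ℝ) := mul_le_mul_of_nonneg_left (by exact_mod_cast hhB) hy0.le
      have h2 : a * (x * (B : ℝ)) ≤ a * S := mul_le_mul_of_nonneg_left hta ha0.le
      linarith
  have wd := dual_le_of_decAtT (a * x) (a * S) J B (gate β a) hy0 hy1 hdecJ α' β' hβ' hαβ'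
  have wd_eq := dual_functional_eq (a * S) J B α' β' (gate β a) hJB
  rw [gate_functional_eq B β (coefAt (a * S) J α' β') a] at wd_eq
  -- the mean identity
  have hmeanid : ∑ h ∈ Finset.range (B + 1), β h * (lam * ((h : ℝ) - S)) = 0 := by
    have : ∑ h ∈ Finset.range (B + 1), β h * (lam * ((h : ℝ) - S))
        = lam * (∑ h ∈ Finset.range (B + 1), (h : ℝ) * β h - S * ∑ h ∈ Finset.range (B + 1), β h) := by
      rw [Finset.mul_sum, ← Finset.sum_sub_distrib, Finset.mul_sum]
      refine Finset.sum_congr rfl fun h _ => by ring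
    rw [this, β1, mul_one, hSdef, sub_self, mul_zero]
  -- row-by-row domination
  have hle : ∑ h ∈ Finset.range (B + 1), β h * gluedPullback (a * (S + m)) q g j r k α p h
      ≤ ∑ h ∈ Finset.range (B + 1), β h * (coefAt (a * S) J α' β' h + lam * ((h : ℝ) - S)) :=
    Finset.sum_le_sum fun h hh => mul_le_mul_of_nonneg_left (hrows h (Nat.lt_succ_iff.1 (Finset.mem_range.1 hh))) (β0 h)
  have hsplit : ∑ h ∈ Finset.range (B + 1), β h * (coefAt (a * S) J α' β' h + lam * ((h : ℝ) - S))
      = ∑ h ∈ Finset.range (B + 1), β h * coefAt (a * S) J α' β' h + ∑ h ∈ Finset.range (B + 1), β h * (lam * ((h : ℝ) - S)) := by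
    rw [← Finset.sum_add_distrib]
    refine Finset.sum_congr rfl fun h _ => by ring
  rw [hsplit, hmeanid, add_zero] at hle
  have hΨ : ∀ h, (1 - q) * coefAt (a * (S + m)) j α p h + q * (1 - g) * coefAt (a * (S + m)) j α p (h + r)
      + q * g * coefAt (a * (S + m)) j α p (h + r + k) = gluedPullback (a * (S + m)) q g j r k α p h := fun h => rfl
  simp_rw [hΨ] at hfun
  -- assemble
  have hG : (1 - a) * coefAt (a * S) J α' β' 0 + a * ∑ h ∈ Finset.range (B + 1), β h * coefAt (a * S) J α' β' h ≤ 0 := by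
    rw [← wd_eq]; linarith
  have hfin : (1 - a) * coefAt (a * (S + m)) j α p 0 + a * ∑ h ∈ Finset.range (B + 1), β h * gluedPullback (a * (S + m)) q g j r k α p h ≤ 0 := by
    have := mul_le_mul_of_nonneg_left hle ha0.le
    linarith
  linarith [hfun ▸ hfin]

end LawDec
end Quant
end Summit.CriticalPhenomena.PercolationContinuityZ3.Theorems
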